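import Mathlib
import Summits.HodgeConjecture.HodgeConjecture.Theses.CurveNetMordellWeil
import Summits.HodgeConjecture.HodgeConjecture.Theorems.CurveNetMordellWeilComplexOrientationExists
import Summits.HodgeConjecture.HodgeConjecture.Theorems.CurveNetMordellWeilGysinPreservesAlgebraic
import Summits.HodgeConjecture.HodgeConjecture.Theorems.CurveNetMordellWeilVerticalSupportBelowMiddleStubVsbmUpper
import Summits.HodgeConjecture.HodgeConjecture.Theorems.CurveNetMordellWeilVerticalSupportBelowMiddleStubVsbmMiddle
import Literature.AlgebraicGeometry.HodgeTheory.LefschetzPencilHyperplaneSections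
import Literature.AlgebraicGeometry.HodgeTheory.SpreadAlgebraicClassesPencil
import Literature.AlgebraicGeometry.HodgeTheory.LerayGluePencil
import Literature.AlgebraicGeometry.Motives.FamiliesVHS
import Literature.AlgebraicGeometry.Motives.SurfaceNet
import Literature.AlgebraicGeometry.Motives.FiberNetExistence
import Literature.AlgebraicGeometry.Motives.VarietiesGeometricallyIntegralProofs
import Literature.AlgebraicGeometry.Motives.VarietiesProjectiveSpaceProofs
import Literature.AlgebraicGeometry.Motives.ProjectiveSpaceFieldPointsBijective
import Literature.AlgebraicGeometry.HodgeTheory.HypersurfaceSectionLefschetz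
import Literature.AlgebraicGeometry.HodgeTheory.IsoTransport
import Literature.AlgebraicGeometry.HodgeTheory.GysinFormalismPushforward
import Literature.NumberTheory.Transcendental.AnalytificationConnected
import Summits.HodgeConjecture.HodgeConjecture.Theorems.CurveNetMordellWeilCurveNetExistsBirational
import Literature.AlgebraicGeometry.HodgeTheory.HodgeTypePullback
import Literature.AlgebraicGeometry.HodgeTheory.HodgeTypeConjugation
import Literature.AlgebraicGeometry.HodgeTheory.ComplexConjugationHolds
import Literature.AlgebraicGeometry.HodgeTheory.HodgeFiltrationModelsReductionProofs

/-!
# Crux #3 `VerticalSupportBelowMiddle` from crux #2 — the Lefschetz climb below the middle degree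
(route `CurveNetMordellWeil`, crux stmt-HodgeConjecture-2783, line `Sketch`, card
`lefschetz-climb-below-middle`)

SORRY-FREE, CONDITIONAL. `VerticalSupportBelowMiddle_of` proves the route decl
`Summit.HodgeConjecture.HodgeConjecture.Theses.CurveNetMordellWeil.VerticalSupportBelowMiddle` from
* the route items `LefschetzOneOne` (tier-0 named fact), `CurveNetExists`, `DeligneDescent` and the
  crux #2 `VerticalSupportMiddle` (the two other support items it needs, `ComplexOrientationExists`
  and `GysinPreservesAlgebraic`, are the tree's theorems `complexOrientationExists_proof`,
  `curveNetMordellWeil_gysinPreservesAlgebraic_proof`), and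
* three classical NAMED FACTS of `Literature/AlgebraicGeometry/HodgeTheory` (explicit
  hypotheses — the result is CONDITIONAL on them): `exists_fiberNet_pencil_weakLefschetz` (pencils of hyperplane sections with weak Lefschetz
  for their smooth members; Voisin II §2.1.1 + Thm 1.23, file `LefschetzPencilHyperplaneSections`),
  `spread_algebraicClasses_over_projectiveLine` (spreading fibrewise algebraic classes over a
  pencil; Voisin II §3.3.1, file `SpreadAlgebraicClassesPencil`) and
  `pencil_restrictCompl_eq_zero_of_forall_fiber_eq_zero` (a class dying on the good fibres of a
  pencil with constant `R^{2q-1}` dies on their union; Leray + Deligne's weights, file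
  `LerayGluePencil`).
In fact `hodge_of_items` proves the Hodge conjecture in EVERY codimension `q` and dimension `n` from
these inputs (strong induction on `q`, then on `n`), and crux #3 follows with its FIRST summand
(the net `pr` is not used). At step `q ≥ 2`:
* `n = 2q` — `stub_vsbm_middle` (LANDED, `…StubVsbmMiddle.lean`): the middle branch of the route's
  deciding theorem `closes` (curve net, crux #2, Deligne descent + induction hypothesis, push-down);
* `n < 2q` — `stub_vsbm_upper` (LANDED, `…StubVsbmUpper.lean`): `ℙ¹`-steps down from the middle
  degree of `X × (ℙ¹)^{2q-n}` (BFNP Lemma 48, upper half; replaces the route item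
  `VerticalSupportAboveMiddle`);
* `n > 2q` — `vsbm_climb` (the card's lever F5): HC(q) CLIMBS from the smooth hyperplane sections
  of `X` to `X` at the price of HC(<q), by induction on `n - 2q`: take a pencil of hyperplane
  sections `(Xt, σ, φ, S)` (`stub_vsbm_pencil`, from the first fact: the tree's `FiberNet r 1 X`,
  its blow-down transfer `FiberNet.span_hodgeClasses_le_map_complexGysin_blowDown`, its smooth fibres,
  and `H^{2q-1}(Xt) ↠ H^{2q-1}(X_t)` — where `2q < n` enters); a rational `(q,q)`-class of `Xt`
  restricts to algebraic classes on the smooth members (HC(n-1, q)); spread them into one algebraic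
  `a` (`stub_vsbm_spread`, the second fact); the defect `c - a` dies on the good fibres hence on
  their union (`stub_vsbm_glue`, the third fact); Deligne descent writes it as Gysin images of
  Hodge classes of codimension `< q`, algebraic by the induction hypothesis; push down by `σ_*`.
-/

-- mandated namespace `Summit.HodgeConjecture.HodgeConjecture.Theorems` (single-problem summit: Problem =
-- Summit) trips `linter.dupNamespace`; off tree-wide in the lakefile, restated for stand-alone elaboration.
set_option linter.dupNamespace false


namespace Summit.HodgeConjecture.HodgeConjecture.Theorems

open CategoryTheory AlgebraicGeometry
open Literature.AlgebraicGeometry Literature.AlgebraicGeometry.Motives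
  Literature.AlgebraicGeometry.HodgeTheory
open Summit.HodgeConjecture.HodgeConjecture.Theses.CurveNetMordellWeil

/-! ## The three stubs of the lever, from the named facts -/

/-- Two complex points of `ℙ¹` with distinct underlying points (`[1:0]` and `[0:1]`). -/
theorem exists_pt_ne_pt_projectiveLine :
    ∃ t₀ t₁ : ComplexPoints (projectiveSpace 1 ℂ), t₀.pt ≠ t₁.pt := by
  have h0 : (![1, 0] : Fin 2 → ℂ) ≠ 0 := fun h ↦ by simpa using congr_fun h 0
  have h1 : (![0, 1] : Fin 2 → ℂ) ≠ 0 := fun h ↦ by simpa using congr_fun h 1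
  refine ⟨ProjectiveSpace.pointOfVec ℂ ![1, 0] h0, ProjectiveSpace.pointOfVec ℂ ![0, 1] h1, ?_⟩
  intro h
  haveI : LocallyOfFiniteType (projectiveSpace 1 ℂ).hom :=
    locallyOfFiniteType_of_isSmoothProjective (isSmoothProjective_projectiveSpace_holds ℂ 1)
  have h' : ProjectiveSpace.pointOfVec ℂ ![1, 0] h0 = ProjectiveSpace.pointOfVec ℂ ![0, 1] h1 :=
    (ComplexPoints.equivClosedPoints (projectiveSpace 1 ℂ)).injective (Subtype.ext h)
  obtain ⟨c, -, hc⟩ := (ProjectiveSpace.pointOfVec_eq_pointOfVec_iff _ _ _ _).mp h'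
  have := congr_fun hc 1
  simp at this

/-- **PENCIL (stub `stub_vsbm_pencil` of line `Sketch`) from the named fact**
`exists_fiberNet_pencil_weakLefschetz` (and nothing else unproved). Witness: the total
space `X̃`, blow-down `σ`, pencil map `π` of the net; `S = Δ ∪ {t₀}` (discriminant plus one closed
point: closed, non-empty, and proper because the smooth base is a dense open of the irreducible `ℙ¹`
and `ℙ¹` has two distinct closed points); transfer
`FiberNet.span_hodgeClasses_le_map_complexGysin_blowDown` (with the Hodge model
`nonempty_hodgeModel_holds`); smooth fibres `FiberNet.isSmoothProjective_fiber_of_mem_smoothBase`;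
weak Lefschetz: `H^{2q-1}(X̃) → H^{2q-1}(X_t)` is onto because `H^{2q-1}(X) → H^{2q-1}(X_t)` through
it is (`2q - 1 < n - 1`). -/
theorem stub_vsbm_pencil (hP : exists_fiberNet_pencil_weakLefschetz) :
    ∀ (μ : OrientationFamily), μ.HasPoincareDuality →
    ∀ ⦃n q : ℕ⦄ ⦃X : SchemeOver ℂ⦄ (hX : IsSmoothProjective n X), 2 ≤ q → 2 * q < n →
      ∃ (Xt : SchemeOver ℂ) (hXt : IsSmoothProjective n Xt) (σ : Xt ⟶ X)
        (φ : Xt ⟶ projectiveSpace 1 ℂ) (S : Set (projectiveSpace 1 ℂ).left),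
        IsClosed S ∧ S.Nonempty ∧ S ≠ Set.univ ∧ Function.Surjective φ.left.base ∧
        (∀ q' : ℕ, Submodule.span ℂ {c : complexBetti X (2 * q') |
            IsRationalClass c ∧ IsOfHodgeType n X (2 * q') q' q' c} ≤
          (Submodule.span ℂ {c : complexBetti Xt (2 * q') |
            IsRationalClass c ∧ IsOfHodgeType n Xt (2 * q') q' q' c}).map
            (complexGysin μ hXt hX σ rfl)) ∧
        (∀ t : ComplexPoints (projectiveSpace 1 ℂ), t.pt ∉ S →
          IsSmoothProjective (n - 1) (fiberOver φ t)) ∧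
        (∀ t : ComplexPoints (projectiveSpace 1 ℂ), t.pt ∉ S →
          Function.Surjective (complexBetti.map (fiberι φ t) (2 * q - 1))) := by
  intro μ hμ n q X hX hq hqn
  obtain ⟨n, rfl⟩ : ∃ n', n = 1 + n' := ⟨n - 1, by omega⟩
  obtain ⟨N, hN⟩ := hP n (by omega) hX
  obtain ⟨t₀, t₁, ht⟩ := exists_pt_ne_pt_projectiveLine
  obtain ⟨B⟩ := nonempty_hodgeModel_holds (n := 1 + n) (X := N.total) N.isSmoothProjective_total
  haveI : IsIntegral (projectiveSpace 1 ℂ).left :=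
    IsSmoothProjective.isIntegral_holds (isSmoothProjective_projectiveSpace_holds ℂ 1)
  refine ⟨N.total, N.isSmoothProjective_total, N.blowDown, N.proj, N.discriminant ∪ {t₀.pt},
    N.isClosed_discriminant.union (ComplexPoints.isClosed_pt t₀), ⟨t₀.pt, Or.inr rfl⟩, ?_,
    N.surjective_proj, fun q' ↦ FiberNet.span_hodgeClasses_le_map_complexGysin_blowDown hμ hX N B q',
    fun t ht ↦ ?_, fun t ht ↦ ?_⟩
  · -- `Δ ∪ {t₀} ≠ ℙ¹`: the smooth base is a dense open and `{t₀}ᶜ` a non-empty open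
    intro hS
    have hdense : Dense (N.smoothBase : Set (projectiveSpace 1 ℂ).left) :=
      N.smoothBase.isOpen.dense N.smoothBase_nonempty_of_charZero
    obtain ⟨x, hx₀, hxU⟩ := hdense.inter_open_nonempty _ (ComplexPoints.isClosed_pt t₀).isOpen_compl
      ⟨t₁.pt, fun h ↦ ht (Set.mem_singleton_iff.mp h).symm⟩
    have hxS : x ∈ N.discriminant ∪ {t₀.pt} := hS ▸ Set.mem_univ x
    rcases hxS with h | h
    · exact hxU h
    · exact hx₀ h
  · -- the fibres off `S` are smooth projective `n`-folds
    have hts : t.pt ∈ N.smoothBase := fun h ↦ ht (Or.inl h)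
    rw [show 1 + n - 1 = n by omega]
    exact N.isSmoothProjective_fiber_of_mem_smoothBase t hts
  · -- weak Lefschetz: `H^{2q-1}(X̃) → H^{2q-1}(X_t)` is onto since `X_t ⟶ X̃ ⟶ X` induces a bijection
    have hts : t.pt ∈ N.smoothBase := fun h ↦ ht (Or.inl h)
    have hb := ((hN t hts).1 (2 * q - 1) (by omega)).2
    have hcomp : ⇑(complexBetti.map (fiberι N.proj t ≫ N.blowDown) (2 * q - 1)) =
        ⇑(complexBetti.map (fiberι N.proj t) (2 * q - 1)) ∘
          ⇑(complexBetti.map N.blowDown (2 * q - 1)) := by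
      rw [complexBetti.map_comp]
      rfl
    rw [hcomp] at hb
    exact hb.of_comp


/-- **GLUE (stub `stub_vsbm_glue` of line `Sketch`) from the named fact**
`pencil_restrictCompl_eq_zero_of_forall_fiber_eq_zero` (verbatim its statement): a class of
`H^{2q}(Xt)` dying on every good fibre of `φ : Xt → ℙ¹` (fibres smooth projective off a non-empty
proper closed `S`, with `H^{2q-1}(Xt) ↠ H^{2q-1}(X_t)`) dies on `φ⁻¹(ℙ¹ ∖ S)` — two-column Leray
over the affine curve, `R^{2q-1}` constant, weights `≥ 2q + 1` against `W_{2q}`, strictness.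
[cite: VoisinHodgeII2003, Thm. 4.11, Lemma 4.13, §4.3.3 and Thm. 4.20]
[cite: DeligneHodgeII1971, Thm. 2.3.5 and Cor. 3.2.17] -/
theorem stub_vsbm_glue (hG : pencil_restrictCompl_eq_zero_of_forall_fiber_eq_zero) :
    ∀ ⦃n q : ℕ⦄ ⦃Xt : SchemeOver ℂ⦄, IsSmoothProjective n Xt →
      ∀ (φ : Xt ⟶ projectiveSpace 1 ℂ) (S : Set (projectiveSpace 1 ℂ).left),
      IsClosed S → S.Nonempty → S ≠ Set.univ →
      (∀ t : ComplexPoints (projectiveSpace 1 ℂ), t.pt ∉ S →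
        IsSmoothProjective (n - 1) (fiberOver φ t)) →
      (∀ t : ComplexPoints (projectiveSpace 1 ℂ), t.pt ∉ S →
        Function.Surjective (complexBetti.map (fiberι φ t) (2 * q - 1))) →
      ∀ δ : complexBetti Xt (2 * q),
        (∀ t : ComplexPoints (projectiveSpace 1 ℂ), t.pt ∉ S →
          complexBetti.map (fiberι φ t) (2 * q) δ = 0) →
        complexBetti.restrictCompl Xt (φ.left.base ⁻¹' S) (2 * q) δ = 0 :=
  hG

/-- **SPREAD (stub `stub_vsbm_spread` of line `Sketch`) from the named fact**
`spread_algebraicClasses_over_projectiveLine`, and nothing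
else unproved: `q = 0` — every class is algebraic in codimension `0` (`algebraicClasses_zero`), take
`a := c`, `S' := S`; `n ≤ q` (with `1 ≤ q`) — take `a := 0`, `S' := S`: the fibres `X_t`, `t ∉ S`,
are smooth projective `(n-1)`-folds and `2(n-1) < 2q`, so `H^{2q}(X_t(ℂ); ℂ) = 0`
(`subsingleton_complexBetti`); `1 ≤ q < n` — the fact. -/
theorem stub_vsbm_spread (h : spread_algebraicClasses_over_projectiveLine) :
    ∀ ⦃n q : ℕ⦄ ⦃Xt : SchemeOver ℂ⦄ (hXt : IsSmoothProjective n Xt)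
      (φ : Xt ⟶ projectiveSpace 1 ℂ) (S : Set (projectiveSpace 1 ℂ).left),
      IsClosed S → S ≠ Set.univ →
      (∀ t : ComplexPoints (projectiveSpace 1 ℂ), t.pt ∉ S →
        IsSmoothProjective (n - 1) (fiberOver φ t)) →
      ∀ c : complexBetti Xt (2 * q), IsRationalClass c → IsOfHodgeType n Xt (2 * q) q q c →
        (∀ t : ComplexPoints (projectiveSpace 1 ℂ), t.pt ∉ S →
          complexBetti.map (fiberι φ t) (2 * q) c ∈ algebraicClasses (fiberOver φ t) q) →
        ∃ a : complexBetti Xt (2 * q), a ∈ algebraicClasses Xt q ∧ IsRationalClass a ∧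
          IsOfHodgeType n Xt (2 * q) q q a ∧
          ∃ S' : Set (projectiveSpace 1 ℂ).left, IsClosed S' ∧ S ⊆ S' ∧ S' ≠ Set.univ ∧
            ∀ t : ComplexPoints (projectiveSpace 1 ℂ), t.pt ∉ S' →
              complexBetti.map (fiberι φ t) (2 * q) (c - a) = 0 := by
  intro n q Xt hXt φ S hS hSne hfib c hc hh hres
  rcases Nat.eq_zero_or_pos q with rfl | hq
  · -- `q = 0`: `a := c`
    refine ⟨c, ?_, hc, hh, S, hS, subset_rfl, hSne, fun t _ => ?_⟩
    · rw [algebraicClasses_zero]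
      exact Submodule.mem_top
    · rw [sub_self, map_zero]
  rcases Nat.lt_or_ge q n with hqn | hqn
  · -- `1 ≤ q < n`: the named fact
    exact h hXt hq hqn φ S hS hSne hfib c hc hres
  · -- `n ≤ q`: `a := 0`, the fibre cohomology `H^{2q}(X_t)` vanishes
    refine ⟨0, Submodule.zero_mem _, IsRationalClass.zero, by simpa using hh.smul 0, S, hS,
      subset_rfl, hSne, fun t ht => ?_⟩
    haveI := subsingleton_complexBetti (hfib t ht) (k := 2 * q) (by omega)
    exact Subsingleton.elim _ _


/-- **The lever F5 (card `lefschetz-climb-below-middle`) from the three stubs**: below the middle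
degree the Hodge conjecture in codimension `q` CLIMBS from dimension `n - 1` to dimension `n` at
the price of the Hodge conjecture in all codimensions `d < q`. Proof: take the pencil
`(Xt, σ, φ, S)` of `stub_vsbm_pencil`; a rational `(q,q)`-class `c` on `Xt` restricts to rational
`(q,q)`-classes on the smooth fibres (`IsRationalClass.pullback`,
`preservesHodgeType_of_nonempty_hodgeModel`), algebraic by HC(n-1, q); `stub_vsbm_spread` gives an
algebraic `a` with `c - a` dying on the fibres off `S' ⊇ S`; `stub_vsbm_glue` (over `S'`: the fibres
off `S'` are still good) kills `c - a` on `φ⁻¹(ℙ¹ ∖ S')`; `DeligneDescent` writes `c - a` as Gysin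
images of rational `(d,d)`-classes, `d < q`, algebraic by hypothesis and `GysinPreservesAlgebraic`;
so `c = (c - a) + a` is algebraic on `Xt`, and `σ_*` (`GysinPreservesAlgebraic`, `e = 0`) carries
HC(q) down to `X`. -/
theorem vsbm_climb (hP : exists_fiberNet_pencil_weakLefschetz)
    (hG : pencil_restrictCompl_eq_zero_of_forall_fiber_eq_zero)
    (hSp : spread_algebraicClasses_over_projectiveLine) :
    ComplexOrientationExists → DeligneDescent → GysinPreservesAlgebraic →
    ∀ ⦃n q : ℕ⦄, 2 ≤ q → 2 * q < n →
      (∀ ⦃Y : SchemeOver ℂ⦄, IsSmoothProjective (n - 1) Y →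
        Submodule.span ℂ {c : complexBetti Y (2 * q) |
          IsRationalClass c ∧ IsOfHodgeType (n - 1) Y (2 * q) q q c} ≤ algebraicClasses Y q) →
      (∀ d : ℕ, d < q → ∀ ⦃m : ℕ⦄ ⦃W : SchemeOver ℂ⦄, IsSmoothProjective m W →
        Submodule.span ℂ {c : complexBetti W (2 * d) |
          IsRationalClass c ∧ IsOfHodgeType m W (2 * d) d d c} ≤ algebraicClasses W d) →
      ∀ ⦃X : SchemeOver ℂ⦄, IsSmoothProjective n X →
        Submodule.span ℂ {c : complexBetti X (2 * q) |
          IsRationalClass c ∧ IsOfHodgeType n X (2 * q) q q c} ≤ algebraicClasses X q := by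
  intro hOr hDesc hGys n q hq hqn hsec ih X hX
  obtain ⟨μ, hμ⟩ := hOr
  obtain ⟨Xt, hXt, σ, φ, S, hS, hSn, hSne, hφ, htr, hfib, hwl⟩ := stub_vsbm_pencil hP μ hμ hX hq hqn
  -- HC(q) on the total space `Xt` of the pencil
  have total : Submodule.span ℂ {c : complexBetti Xt (2 * q) |
      IsRationalClass c ∧ IsOfHodgeType n Xt (2 * q) q q c} ≤ algebraicClasses Xt q := by
    refine Submodule.span_le.2 ?_
    rintro c ⟨hc, hh⟩
    -- the restrictions to the smooth fibres are rational `(q,q)`-classes, hence algebraic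
    have hres : ∀ t : ComplexPoints (projectiveSpace 1 ℂ), t.pt ∉ S →
        complexBetti.map (fiberι φ t) (2 * q) c ∈ algebraicClasses (fiberOver φ t) q := by
      intro t ht
      have hYt := hfib t ht
      refine hsec hYt (Submodule.subset_span ⟨hc.pullback _, ?_⟩)
      exact preservesHodgeType_of_nonempty_hodgeModel hodgePQ_independent_of_hodgeModel_holds
        nonempty_hodgeModel_holds hYt hXt (fiberι φ t) hh
    obtain ⟨a, ha, harat, hah, S', hS', hSS', hS'ne, hvan⟩ :=
      stub_vsbm_spread hSp hXt φ S hS hSne hfib c hc hh hres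
    -- the defect `c - a` dies on the fibres off `S'`, hence off `φ⁻¹ S'` (GLUE)
    have hδ0 : complexBetti.restrictCompl Xt (φ.left.base ⁻¹' S') (2 * q) (c - a) = 0 :=
      stub_vsbm_glue hG hXt φ S' hS' (hSn.mono hSS') hS'ne (fun t ht => hfib t fun h => ht (hSS' h))
        (fun t ht => hwl t fun h => ht (hSS' h)) (c - a) hvan
    have hY : IsClosed (φ.left.base ⁻¹' S') := hS'.preimage φ.left.base.hom.continuous
    have hYne : φ.left.base ⁻¹' S' ≠ Set.univ := by
      intro hU
      apply hS'ne
      refine Set.eq_univ_of_forall fun t => ?_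
      obtain ⟨x, rfl⟩ := hφ t
      have hx : x ∈ φ.left.base ⁻¹' S' := by
        rw [hU]
        exact Set.mem_univ x
      exact hx
    have hδrat : IsRationalClass (c - a) := by
      have h := hc.add (harat.smul (-1))
      simpa [sub_eq_add_neg] using h
    have hδh : IsOfHodgeType n Xt (2 * q) q q (c - a) := hh.sub hXt hah
    -- Deligne descent of the defect, then the induction hypothesis in codimension `d < q`
    have hmem := hDesc μ hμ hXt (φ.left.base ⁻¹' S') hY hYne (c - a) hδrat hδh hδ0
    have aux : ∀ T : Submodule ℂ (complexBetti Xt (2 * q)), c - a ∈ T →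
        T ≤ algebraicClasses Xt q → c - a ∈ algebraicClasses Xt q := fun T h₁ h₂ => h₂ h₁
    have hδalg : c - a ∈ algebraicClasses Xt q := by
      refine aux _ hmem ?_
      refine iSup_le fun d => iSup_le fun e => iSup_le fun hde => iSup_le fun he =>
        iSup_le fun W => iSup_le fun m' => iSup_le fun hm => iSup_le fun hW => iSup_le fun g => ?_
      subst hde
      exact (Submodule.map_mono (ih d (by omega) hW)).trans (hGys μ hμ hW hXt g hm)
    rw [show c = (c - a) + a from (sub_add_cancel c a).symm]
    exact Submodule.add_mem _ hδalg ha
  -- push HC(q) down to `X` along `σ` (Gysin with `e = 0`)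
  exact (htr q).trans ((Submodule.map_mono total).trans (hGys μ hμ hXt hX σ (show n + 0 = n by omega)))

-- `stub_vsbm_upper` (above the middle, `ℙ¹`-steps): LANDED, p103981 —
-- `Theorems/CurveNetMordellWeilVerticalSupportBelowMiddleStubVsbmUpper.lean` (imported; used below by name).
-- `stub_vsbm_middle` (the middle degree from crux #2): LANDED, p105768 —
-- `Theorems/CurveNetMordellWeilVerticalSupportBelowMiddleStubVsbmMiddle.lean` (imported; used below by name).

/-! ## Composition (proved) -/

/-- The Hodge conjecture in every codimension `q` and every dimension `n` from the route items
`LefschetzOneOne`, `ComplexOrientationExists`, `CurveNetExists`, `DeligneDescent`,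
`GysinPreservesAlgebraic`, `VerticalSupportMiddle` and the three stubs: strong induction on `q`
(`q = 0`: `algebraicClasses_zero`; `q = 1`: `LefschetzOneOne`), then at `q ≥ 2` the middle
(`stub_vsbm_middle`), the degrees above it (`stub_vsbm_upper`) and an induction on `n - 2q` below it
(`vsbm_climb`). -/
theorem hodge_of_items (hP : exists_fiberNet_pencil_weakLefschetz)
    (hG : pencil_restrictCompl_eq_zero_of_forall_fiber_eq_zero)
    (hSp : spread_algebraicClasses_over_projectiveLine) (hL11 : LefschetzOneOne) (hOr : ComplexOrientationExists)
    (hNet : CurveNetExists) (hDesc : DeligneDescent) (hGys : GysinPreservesAlgebraic)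
    (hMid : VerticalSupportMiddle) :
    ∀ (q : ℕ) ⦃n : ℕ⦄ ⦃X : SchemeOver ℂ⦄, IsSmoothProjective n X →
      Submodule.span ℂ {c : complexBetti X (2 * q) |
        IsRationalClass c ∧ IsOfHodgeType n X (2 * q) q q c} ≤ algebraicClasses X q := by
  intro q
  induction q using Nat.strong_induction_on with
  | _ q ih =>
  rcases Nat.lt_or_ge q 2 with hq | hq
  · intro n X hX
    interval_cases q
    · rw [algebraicClasses_zero]
      exact le_top
    · exact Submodule.span_le.2 fun c hc => hL11 hX c hc.1 hc.2
  -- the middle degree `n = 2q`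
  have hmid : ∀ ⦃Y : SchemeOver ℂ⦄, IsSmoothProjective (2 * q) Y →
      Submodule.span ℂ {c : complexBetti Y (2 * q) |
        IsRationalClass c ∧ IsOfHodgeType (2 * q) Y (2 * q) q q c} ≤ algebraicClasses Y q :=
    stub_vsbm_middle hOr hNet hDesc hGys hMid hq (fun d hd m W hW => ih d hd hW)
  -- below the middle: induction on `k = n - 2q`
  have hbelow : ∀ (k : ℕ) ⦃n : ℕ⦄, n = 2 * q + k → ∀ ⦃X : SchemeOver ℂ⦄, IsSmoothProjective n X →
      Submodule.span ℂ {c : complexBetti X (2 * q) |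
        IsRationalClass c ∧ IsOfHodgeType n X (2 * q) q q c} ≤ algebraicClasses X q := by
    intro k
    induction k with
    | zero =>
      intro n hn X hX
      subst hn
      exact hmid hX
    | succ k ihk =>
      intro n hn X hX
      subst hn
      exact vsbm_climb hP hG hSp hOr hDesc hGys hq (by omega)
        (fun Y hY => ihk (n := 2 * q + (k + 1) - 1) (by omega) hY)
        (fun d hd m W hW => ih d hd hW) hX
  intro n X hX
  rcases Nat.lt_or_ge (2 * q) n with hn | hn
  · exact hbelow (n - 2 * q) (by omega) hX
  · exact stub_vsbm_upper (2 * q - n) (by omega) hmid hX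

/-- **Crux #3 from crux #2** (line `Sketch`, card `lefschetz-climb-below-middle`): the route items
`LefschetzOneOne`, `CurveNetExists`, `DeligneDescent` and `VerticalSupportMiddle` imply
`VerticalSupportBelowMiddle` — every rational `(q,q)`-class is already in the FIRST summand
`algebraicClasses X q` (`hodge_of_items`, with the proved support items
`complexOrientationExists_proof` and `curveNetMordellWeil_gysinPreservesAlgebraic_proof`); the net
`pr` is not used. -/
theorem VerticalSupportBelowMiddle_of (hP : exists_fiberNet_pencil_weakLefschetz)
    (hG : pencil_restrictCompl_eq_zero_of_forall_fiber_eq_zero)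
    (hSp : spread_algebraicClasses_over_projectiveLine)
    (hL11 : LefschetzOneOne) (hNet : CurveNetExists)
    (hDesc : DeligneDescent) (hMid : VerticalSupportMiddle) : VerticalSupportBelowMiddle := by
  intro n q m X pr hX _hq _hqn _hm _hpr
  exact (hodge_of_items hP hG hSp hL11 complexOrientationExists_proof hNet hDesc
    curveNetMordellWeil_gysinPreservesAlgebraic_proof hMid q hX).trans le_sup_left

end Summit.HodgeConjecture.HodgeConjecture.Theorems
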